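import Summits.BirchSwinnertonDyer.BirchSwinnertonDyer.Theorems.KolyvaginDepthDoorDepthTableSteinWuthrichRows9
import Summits.BirchSwinnertonDyer.BirchSwinnertonDyer.Theorems.KolyvaginDepthDoorDepthTableRowRankThree5077a1NoTwist
import HarnessLib

/-!
# Route `KolyvaginDepthDoor`, crux `KolyvaginDepthSupplyKN` (stmt-BirchSwinnertonDyer-22820) —
# DEPTH TABLE v14 (part 1): THE ODD-RANK ROWS in the v13 currency — `5077a1` (rank `3`):
# `Ш(E)[5] = 0` BY NAME (Stein–Wuthrich 2013 Thm. 1.1) and the crux's clause at the curve modulo ONE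
# `5`-Selmer bound on the Heegner twist, whose analytic rank is EVEN (a RANK-ZERO datum where `L(E^{(d)},1) ≠ 0`)

Helper file of the lead prover of line `levelone` (kdd-p1 g18; `--supports stmt-BirchSwinnertonDyer-22820
--as helper`); it closes nothing and BSD is NOT proved by it.

WHAT IS NEW. The lineage's depth table in the exact / v13 currency (g14–g17: «one bit ⟺ one twist»,
«the crux at the curve modulo ONE twist `p`-Selmer bound») covers the eighteen RANK-TWO curves `N ≤ 1000`.
The nine kernel-certified RANK-THREE atlas curves (g6–g8: `…DepthTableRowRankThree5077a1NoTwist`,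
`…RowsRankThreeNoTwist2…5`, `…RowsRankThreeKN1…5` — door direction, on (γ) / the McCallum–Gross leaves)
were never read in that currency. They all lie in the Stein–Wuthrich range (`N ≤ 22 696 ≤ 30 000`,
semistable, `5` good ordinary, `ρ̄_{E,5}` onto, non-CM, `3 ≤ rank` in the kernel), so:

* `C5077a1.sha_inf_torsionBy_five_eq_bot` — `Ш(5077a1/ℚ)[5] = 0` BY NAME (SW Thm. 1.1 at the kernel
  certificates; new certificates here: `card_5` / `goodOrdinary_5` (`a_5 = −4`), `conductorNorm_eq`
  (`N = Δ = 5077`, semistable), `spade_5` (♠ at `5`)).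
* `C5077a1.cruxBody_of_twistSelmer` — **the CLAUSE of `KolyvaginDepthSupplyKN` at `5077a1` VERBATIM from
  ONE bound `#Sel_5(E^{(d_K)}/ℚ) ≤ 5³`** for one imaginary quadratic `K` with `d_K = −7` (Heegner for
  `5077`, `5` inert): witnesses `p = 5`, that `K`, W. Zhang's level-one class (Lemma 8.4 (1) / Thm. 9.1 by
  name) at depth `≤ rank − 1`, first sign. Generic engine: g17's `cruxBody_of_twistSelmer_of_steinWuthrich`
  with `5³ ≤ 5^rank` from `three_le_rank`.
* `cruxBody_of_twistSelmer_trivial_of_steinWuthrich` (generic) — **the RANK-ZERO currency**: in the SW range,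
  if the Heegner twist has TRIVIAL `p`-Selmer group, `#Sel_p(E^{(d_K)}/ℚ) = 1`, the crux's clause holds at
  the curve. At EVEN rank this is void (the twist has odd analytic rank, `Sel_p ⊇ E^{(d)}(ℚ)/p ≠ 0`); at
  ODD rank `r ≥ 3` the twist `E^{(d_K)}` has EVEN analytic rank, and where `L(E^{(d_K)}, 1) ≠ 0` the
  closing datum of the row is `Sel_p(E^{(d_K)}/ℚ) = 0` — the `p`-part of BSD of a RANK-ZERO curve
  (Kolyvagin / Kato: an index or the exact value `L(E^{(d)},1)/Ω` by modular symbols; NO Heegner point of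
  infinite order, NO `p`-adic height or regulator), cheaper than the rank-one datum of every even-rank row
  (`CLOSING-DATA-v13.md`). For `5077a1` and `K = ℚ(√−7)` this is Gross–Zagier's original pair
  (`L(E^{(−7)}, 1) ≠ 0`, `ord_{s=1} L(E/K, s) = 3`).
* `cruxBody_of_twist_analyticRank_zero_sha_of_steinWuthrich` (generic) — the same in BSD invariants: analytic rank
  `0` of the twist (Gross–Zagier–Kolyvagin by name: rank `0`) ∧ `Ш(E^{(d_K)}/ℚ)[p] = 0` ⟹ the clause; the one
  non-print input is «`Ш[p] = 0` of ONE analytic-rank-zero curve» (Kolyvagin's / Kato's bound by the algebraic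
  part of `L(E^{(d_K)}, 1)`).

CONDITIONAL on the named print facts Stein–Wuthrich 2013 Thm. 1.1, W. Zhang 2014 Lemma 8.4 (1) /
Thm. 9.1 and (one lemma) Gross–Zagier–Kolyvagin; per curve; nothing class-wide (the open stub (S♭) is untouched); BSD is NOT proved by any of this.

References: [SteinWuthrich2013] Thm. 1.1 (p. 1758), §12.4; [WZhang2014] Lemma 8.4 (1) (p. 236), Thm. 9.1
(p. 240), Hypothesis ♠ (pp. 194–195); [GrossZagier1986] §V.4 (the curve of conductor `5077`);
[KolyvaginEulerSystems1990] Thm. A; [CremonaAlgorithms1997] Table 1 (5077a1); [SilvermanAEC2009] VII.5.1.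
-/

set_option linter.dupNamespace false

noncomputable section

open scoped Classical NumberField

namespace Summit.BirchSwinnertonDyer.BirchSwinnertonDyer.Theorems.KolyvaginDepthDoor

open Literature.NumberTheory.EllipticCurves Literature.NumberTheory.EllipticCurves.ModularForms
  WeierstrassCurve NumberField IsDedekindDomain
open Summit.BirchSwinnertonDyer.BirchSwinnertonDyer.Theorems
open Summit.BirchSwinnertonDyer.BirchSwinnertonDyer.Rank2Observatory
open Summit.BirchSwinnertonDyer.BirchSwinnertonDyer.Rank1Residual
open Summit.BirchSwinnertonDyer.Rank1Residual.Additive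

/-! ## Generic: the RANK-ZERO currency — a trivial twist `p`-Selmer group closes the row -/

/-- **In the Stein–Wuthrich range, a TRIVIAL `p`-Selmer group of the Heegner twist gives the clause of
`KolyvaginDepthSupplyKN` at the curve** (generic; the rank-zero currency of the odd-rank rows). `W` globally
minimal, non-CM, `2 ≤ rank_ℤ E(ℚ)`, `N_E ≤ 30 000`; `5 ≤ p < 1000` good ordinary with `ρ_{E,p^n}` onto for
all `n`, Kodaira–Néron at `p`, ♠ (1), ♠ (2) (`p`-form); `K` imaginary quadratic, `d_K ∉ {−3, −4}`, `p ∤ d_K`,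
Heegner for `N_E`. IF `#Sel_p(E^{(d_K)}/ℚ) = 1` THEN the crux's clause holds at `W` verbatim
(`cruxBody_of_twistSelmer_of_steinWuthrich` with `1 ≤ p ^ rank`). Only an ODD-rank curve can meet the
hypothesis (at even rank the Heegner twist has odd analytic rank); where `L(E^{(d_K)}, 1) ≠ 0` it is the
`p`-part of BSD of a rank-zero curve. CONDITIONAL on the two named facts; per `(E, p, K)`; BSD is not proved
by it. [cite: SteinWuthrich2013, Thm. 1.1 (p. 1758)] [cite: WZhang2014, Lemma 8.4 (1) (p. 236), Thm. 9.1 (p. 240)] -/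
theorem cruxBody_of_twistSelmer_trivial_of_steinWuthrich
    (hSW : SteinWuthrich2013_sha_inf_torsionBy_eq_bot_of_two_le_rank)
    (h84 : Literature.NumberTheory.EllipticCurves.WZhang2014_lemma84_exists_minimal_kolyvaginClass_one_selmerCard)
    (W : WeierstrassCurve ℚ) [W.IsElliptic] [W.IsGloballyMinimal] (hcm : ¬ W.HasCM) (hr : 2 ≤ W.mordellWeilRank)
    (hN : W.conductorNorm ℤ ≤ 30000)
    (p : ℕ) [hp : Fact p.Prime] (h5 : 5 ≤ p) (hp1000 : p < 1000) (hgood : W.HasGoodReductionAtPrime p)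
    (hord : ¬ (p : ℤ) ∣ W.frobeniusTrace p)
    (htower : ∀ n : ℕ, W.HasSurjectiveModNGaloisRep (p ^ n : ℕ))
    (hKN : ∀ v : HeightOneSpectrum (𝓞 ℚ), W.HasMultiplicativeReductionAt v →
      ¬ p ∣ W.ordMinimalDiscriminant v)
    (hS1 : ∀ (ℓ : ℕ) [Fact ℓ.Prime], W.HasMultiplicativeReductionAtPrime ℓ →
      ¬ p ∣ padicValInt ℓ W.minimalDiscriminantInt)
    (hS2 : ¬ Squarefree (W.conductorNorm ℤ) →
      (∃ (ℓ : ℕ) (_ : Fact ℓ.Prime), W.HasMultiplicativeReductionAtPrime ℓ ∧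
          ¬ p ∣ padicValInt ℓ W.minimalDiscriminantInt) ∧
        ∃ (ℓ₁ ℓ₂ : ℕ) (_ : Fact ℓ₁.Prime) (_ : Fact ℓ₂.Prime), ℓ₁ ≠ ℓ₂ ∧
          W.HasMultiplicativeReductionAtPrime ℓ₁ ∧ W.HasMultiplicativeReductionAtPrime ℓ₂)
    (K : Type) [Field K] [NumberField K] (hK : IsImaginaryQuadratic K)
    (hD3 : NumberField.discr K ≠ -3) (hD4 : NumberField.discr K ≠ -4)
    (hpD : ¬ ((p : ℤ) ∣ NumberField.discr K))
    [iNZ : NeZero (W.conductorNorm ℤ)] (hH : SatisfiesHeegnerHypothesis (W.conductorNorm ℤ) K)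
    (hT : Nat.card ((W.quadraticTwist (NumberField.discr K : ℚ)).selmerGroup p) = 1) :
    ∃ (p : ℕ) (hp : Fact p.Prime), 5 ≤ p ∧ W.HasGoodReductionAtPrime p ∧
      ¬ (p : ℤ) ∣ W.frobeniusTrace p ∧ (∀ n : ℕ, W.HasSurjectiveModNGaloisRep (p ^ n : ℕ)) ∧
      (∀ v : HeightOneSpectrum (𝓞 ℚ), W.HasMultiplicativeReductionAt v →
        ¬ p ∣ W.ordMinimalDiscriminant v) ∧
      ∃ (K : Type) (_ : Field K) (_ : NumberField K), IsImaginaryQuadratic K ∧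
        NumberField.discr K ≠ -3 ∧ NumberField.discr K ≠ -4 ∧
        ∃ (_ : NeZero (W.conductorNorm ℤ)), SatisfiesHeegnerHypothesis (W.conductorNorm ℤ) K ∧
        ∃ (Dt : ModularParametrizationData W (W.conductorNorm ℤ)) (β : ℤ) (ι : K →+* ℂ) (n₁ : ℕ)
          (d : KolyvaginHeegnerData Dt β ι n₁), Squarefree n₁ ∧
          (∀ q ∈ n₁.primeFactors, Zhang2014.IsKolyvaginPrime (W.conductorNorm ℤ) W K p q) ∧
          d.kolyvaginClass hp.out 1 ≠ 0 ∧
          (n₁.primeFactors.card + 1 ≤ W.mordellWeilRank ∨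
            (n₁.primeFactors.card ≤ W.mordellWeilRank ∧
              n₁.primeFactors.card + 1 ≤ (W.quadraticTwist (NumberField.discr K : ℚ)).mordellWeilRank)) :=
  cruxBody_of_twistSelmer_of_steinWuthrich hSW h84 W hcm hr hN p h5 hp1000 hgood hord htower hKN hS1 hS2
    K hK hD3 hD4 hpD hH (by rw [hT]; exact Nat.one_le_pow _ _ hp.out.pos)

/-- **The RANK-ZERO currency in BSD invariants** (generic, Stein–Wuthrich range): if the Heegner twist
`E^{(d_K)}` has ANALYTIC RANK `0` and `Ш(E^{(d_K)}/ℚ)[p] = 0`, the clause of `KolyvaginDepthSupplyKN` holds at the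
curve. Gross–Zagier–Kolyvagin by name (`rank_eq_analyticRank_of_analyticRank_le_one`: `rank E^{(d)} = 0`), the
twist-invariance of irreducibility (`hasIrreducibleModPGaloisRep_quadraticTwist_iff`, so `E^{(d)}(ℚ)[p] = 0`) and
the exact Selmer count (`natCard_selmerGroup_eq_pow_rank_of_sha_inf_torsionBy_eq_bot`) give `#Sel_p(E^{(d_K)}/ℚ) =
p⁰ = 1`, and `cruxBody_of_twistSelmer_trivial_of_steinWuthrich` concludes. So at an ODD-rank curve of the SW table
with `L(E^{(d_K)}, 1) ≠ 0` the per-curve instance of the crux is «`Ш[p] = 0` for ONE analytic-rank-ZERO curve» away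
— the input Kolyvagin's / Kato's Euler systems bound by the algebraic part of `L(E^{(d_K)}, 1)`. CONDITIONAL on the
three named facts; per `(E, p, K)`; BSD is not proved by it. [cite: SteinWuthrich2013, Thm. 1.1 (p. 1758)]
[cite: WZhang2014, Lemma 8.4 (1) (p. 236), Thm. 9.1 (p. 240)] [cite: Darmon2004, Thm. 3.22] [cite: SilvermanAEC2009, X.5 Cor. 5.4, X.4.2] -/
theorem cruxBody_of_twist_analyticRank_zero_sha_of_steinWuthrich
    (hSW : SteinWuthrich2013_sha_inf_torsionBy_eq_bot_of_two_le_rank)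
    (h84 : Literature.NumberTheory.EllipticCurves.WZhang2014_lemma84_exists_minimal_kolyvaginClass_one_selmerCard)
    (hGZK : rank_eq_analyticRank_of_analyticRank_le_one)
    (W : WeierstrassCurve ℚ) [W.IsElliptic] [W.IsGloballyMinimal] (hcm : ¬ W.HasCM) (hr : 2 ≤ W.mordellWeilRank)
    (hN : W.conductorNorm ℤ ≤ 30000)
    (p : ℕ) [hp : Fact p.Prime] (h5 : 5 ≤ p) (hp1000 : p < 1000) (hgood : W.HasGoodReductionAtPrime p)
    (hord : ¬ (p : ℤ) ∣ W.frobeniusTrace p)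
    (htower : ∀ n : ℕ, W.HasSurjectiveModNGaloisRep (p ^ n : ℕ))
    (hKN : ∀ v : HeightOneSpectrum (𝓞 ℚ), W.HasMultiplicativeReductionAt v →
      ¬ p ∣ W.ordMinimalDiscriminant v)
    (hS1 : ∀ (ℓ : ℕ) [Fact ℓ.Prime], W.HasMultiplicativeReductionAtPrime ℓ →
      ¬ p ∣ padicValInt ℓ W.minimalDiscriminantInt)
    (hS2 : ¬ Squarefree (W.conductorNorm ℤ) →
      (∃ (ℓ : ℕ) (_ : Fact ℓ.Prime), W.HasMultiplicativeReductionAtPrime ℓ ∧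
          ¬ p ∣ padicValInt ℓ W.minimalDiscriminantInt) ∧
        ∃ (ℓ₁ ℓ₂ : ℕ) (_ : Fact ℓ₁.Prime) (_ : Fact ℓ₂.Prime), ℓ₁ ≠ ℓ₂ ∧
          W.HasMultiplicativeReductionAtPrime ℓ₁ ∧ W.HasMultiplicativeReductionAtPrime ℓ₂)
    (K : Type) [Field K] [NumberField K] (hK : IsImaginaryQuadratic K)
    (hD3 : NumberField.discr K ≠ -3) (hD4 : NumberField.discr K ≠ -4)
    (hpD : ¬ ((p : ℤ) ∣ NumberField.discr K))
    [iNZ : NeZero (W.conductorNorm ℤ)] (hH : SatisfiesHeegnerHypothesis (W.conductorNorm ℤ) K)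
    (hT0 : (W.quadraticTwist (NumberField.discr K : ℚ)).analyticRank = 0)
    (hshaT : ((W.quadraticTwist (NumberField.discr K : ℚ)).sha ⊓
        AddSubgroup.torsionBy (W.quadraticTwist (NumberField.discr K : ℚ)).galH1 (p : ℤ) :
        AddSubgroup (W.quadraticTwist (NumberField.discr K : ℚ)).galH1) = ⊥) :
    ∃ (p : ℕ) (hp : Fact p.Prime), 5 ≤ p ∧ W.HasGoodReductionAtPrime p ∧
      ¬ (p : ℤ) ∣ W.frobeniusTrace p ∧ (∀ n : ℕ, W.HasSurjectiveModNGaloisRep (p ^ n : ℕ)) ∧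
      (∀ v : HeightOneSpectrum (𝓞 ℚ), W.HasMultiplicativeReductionAt v →
        ¬ p ∣ W.ordMinimalDiscriminant v) ∧
      ∃ (K : Type) (_ : Field K) (_ : NumberField K), IsImaginaryQuadratic K ∧
        NumberField.discr K ≠ -3 ∧ NumberField.discr K ≠ -4 ∧
        ∃ (_ : NeZero (W.conductorNorm ℤ)), SatisfiesHeegnerHypothesis (W.conductorNorm ℤ) K ∧
        ∃ (Dt : ModularParametrizationData W (W.conductorNorm ℤ)) (β : ℤ) (ι : K →+* ℂ) (n₁ : ℕ)
          (d : KolyvaginHeegnerData Dt β ι n₁), Squarefree n₁ ∧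
          (∀ q ∈ n₁.primeFactors, Zhang2014.IsKolyvaginPrime (W.conductorNorm ℤ) W K p q) ∧
          d.kolyvaginClass hp.out 1 ≠ 0 ∧
          (n₁.primeFactors.card + 1 ≤ W.mordellWeilRank ∨
            (n₁.primeFactors.card ≤ W.mordellWeilRank ∧
              n₁.primeFactors.card + 1 ≤ (W.quadraticTwist (NumberField.discr K : ℚ)).mordellWeilRank)) := by
  have hdK : (NumberField.discr K : ℚ) ≠ 0 := by exact_mod_cast NumberField.discr_ne_zero K
  haveI := W.isElliptic_quadraticTwist hdK
  have hsur : W.HasSurjectiveModNGaloisRep p := by simpa only [pow_one] using htower 1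
  have hirr : W.HasIrreducibleModPGaloisRep p :=
    hasIrreducibleModPGaloisRep_of_hasSurjectiveModNGaloisRep W p hsur
  have hirrT : (W.quadraticTwist (NumberField.discr K : ℚ)).HasIrreducibleModPGaloisRep p :=
    (W.hasIrreducibleModPGaloisRep_quadraticTwist_iff hdK p).mpr hirr
  have hrT : (W.quadraticTwist (NumberField.discr K : ℚ)).mordellWeilRank = 0 := by
    have h := (hGZK (W.quadraticTwist (NumberField.discr K : ℚ)) (by rw [hT0]; norm_num)).1
    rw [h, hT0]
  have hSelT : Nat.card ((W.quadraticTwist (NumberField.discr K : ℚ)).selmerGroup p) = 1 := by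
    rw [natCard_selmerGroup_eq_pow_rank_of_sha_inf_torsionBy_eq_bot _ p hirrT hshaT, hrT, pow_zero]
  exact cruxBody_of_twistSelmer_trivial_of_steinWuthrich hSW h84 W hcm hr hN p h5 hp1000 hgood hord htower hKN
    hS1 hS2 K hK hD3 hD4 hpD hH hSelT

/-! ## `5077a1` (`[0,0,1,−7,6]`, `N = Δ = 5077`, rank `3`) at `(p, d_K) = (5, −7)` -/

namespace C5077a1

/-- `#Ẽ(𝔽₅)(5077a1) = 10`, i.e. `a_5 = −4` (kernel-decided by the `ℕ`-arithmetic Euler count).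
[cite: CremonaAlgorithms1997, Table 1 (5077a1)] -/
theorem card_5 :
    Nat.card (((⟨0, 0, 1, -7, 6⟩ : WeierstrassCurve ℤ).map (Int.castRingHom (ZMod 5))).toAffine.Point) =
      10 := by
  rw [PointCountNat.natCard_point_map_eq (hℓ := ⟨by norm_num⟩) (by norm_num) 0 0 1 (-7) 6
    (by decide +kernel)]
  decide +kernel

/-- **`5` is a prime of good ORDINARY reduction for `5077a1`** (`5 ∤ Δ = 5077`, `a_5 = −4 ≢ 0 (mod 5)`).
[cite: CremonaAlgorithms1997, Table 1 (5077a1)] [cite: SilvermanAEC2009, VII.5 Prop. 5.1 (a)] -/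
theorem goodOrdinary_5 :
    haveI := isGloballyMinimal_of_mem_atlasR3A00 mem_atlas;
    haveI := Fact.mk (by norm_num : Nat.Prime 5);
    (c5077a1.e.baseChange ℚ).HasGoodReductionAtPrime 5 ∧
      ¬ ((5 : ℕ) : ℤ) ∣ (c5077a1.e.baseChange ℚ).frobeniusTrace 5 := by
  haveI := isGloballyMinimal_of_mem_atlasR3A00 mem_atlas
  haveI := Fact.mk (by norm_num : Nat.Prime 5)
  exact goodOrdinary_of_intModel_certificate intModel 5 (by decide +kernel) (n := 10) card_5
    (by decide +kernel)

/-- **`N(5077a1) = 5077`** (semistable: `gcd(Δ, c₄) = gcd(5077, 336) = 1`, `N = rad Δ = 5077`, prime;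
Silverman ATAEC IV.10.2). [cite: CremonaAlgorithms1997, Table 1 (5077a1)] [cite: Silverman1994, IV.10.2 (a),(b)] -/
theorem conductorNorm_eq :
    haveI := isElliptic_of_mem_atlasR3A00 mem_atlas;
    (c5077a1.e.baseChange ℚ).conductorNorm ℤ = 5077 := by
  haveI := isElliptic_of_mem_atlasR3A00 mem_atlas
  haveI := isGloballyMinimal_of_mem_atlasR3A00 mem_atlas
  have h : c5077a1.e.baseChange ℚ = (⟨0, 0, 1, -7, 6⟩ : WeierstrassCurve ℤ).baseChange ℚ :=
    eq_baseChange_of_intModel intModel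
  haveI : ((⟨0, 0, 1, -7, 6⟩ : WeierstrassCurve ℤ).baseChange ℚ).IsElliptic := by rw [← h]; infer_instance
  rw [h]
  refine BurungaleSkinner2023.conductorNorm_baseChange_int_of_isCoprime _
    (by rw [Int.isCoprime_iff_gcd_eq_one]; decide +kernel) (k := 1) ?_ (by decide +kernel)
    (by decide +kernel)
  rw [Nat.squarefree_iff_nodup_primeFactorsList (by norm_num)]; simp

/-- **♠ for `5077a1` at `p = 5`:** `|Δ_min| = 5077` (one prime, exponent `1`) ⇒ `5 ∤ v_ℓ(Δ_min)` at every
multiplicative `ℓ`; `gcd(c₄, Δ) = 1` ⇒ semistable over `ℤ`. [cite: WZhang2014, Hypothesis ♠ (pp. 194–195)]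
[cite: CremonaAlgorithms1997, Table 1 (5077a1)] -/
theorem spade_5 :
    haveI := isElliptic_of_mem_atlasR3A00 mem_atlas;
    haveI := isGloballyMinimal_of_mem_atlasR3A00 mem_atlas;
    (∀ (ℓ : ℕ) [Fact ℓ.Prime], (c5077a1.e.baseChange ℚ).HasMultiplicativeReductionAtPrime ℓ →
      ¬ 5 ∣ padicValInt ℓ (c5077a1.e.baseChange ℚ).minimalDiscriminantInt) ∧
      (c5077a1.e.baseChange ℚ).IsSemistable ℤ := by
  haveI := isElliptic_of_mem_atlasR3A00 mem_atlas
  haveI := isGloballyMinimal_of_mem_atlasR3A00 mem_atlas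
  haveI := Fact.mk (by norm_num : Nat.Prime 5)
  exact ⟨not_dvd_padicValInt_of_intModel intModel 5
      (forall_prime_dvd_of_natAbs_eq_pow (a := 5077) (i := 1) (by decide +kernel) (by norm_num)
        ⟨1, by decide +kernel, by decide +kernel, by norm_num⟩),
    isSemistable_int_of_intModel_of_isCoprime intModel
      (by rw [Int.isCoprime_iff_gcd_eq_one]; decide +kernel)⟩

/-- **`Ш(5077a1/ℚ)[5] = 0` BY NAME** — Stein–Wuthrich 2013 Thm. 1.1 at the kernel certificates: non-CM
`not_hasCM`, `2 ≤ 3 ≤ rank` `three_le_rank`, `N = 5077 ≤ 30 000` `conductorNorm_eq`, `5` good ordinary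
`goodOrdinary_5`, `ρ̄_{E,5}` onto `hasSurjectiveModNGaloisRep_pow_5 1`. The first ODD-RANK instance of the fact
in the tree. CONDITIONAL on that named fact; per curve; BSD is not proved by it.
[cite: SteinWuthrich2013, Thm. 1.1 (p. 1758)] [cite: CremonaAlgorithms1997, Table 1 (5077a1)] -/
theorem sha_inf_torsionBy_five_eq_bot (hSW : SteinWuthrich2013_sha_inf_torsionBy_eq_bot_of_two_le_rank) :
    haveI := isElliptic_of_mem_atlasR3A00 mem_atlas;
    haveI := Fact.mk (by norm_num : Nat.Prime 5);
    ((c5077a1.e.baseChange ℚ).sha ⊓ AddSubgroup.torsionBy (c5077a1.e.baseChange ℚ).galH1 ((5 : ℕ) : ℤ) :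
      AddSubgroup _) = ⊥ := by
  haveI := isElliptic_of_mem_atlasR3A00 mem_atlas
  haveI := isGloballyMinimal_of_mem_atlasR3A00 mem_atlas
  haveI := Fact.mk (by norm_num : Nat.Prime 5)
  have hsur : (c5077a1.e.baseChange ℚ).HasSurjectiveModNGaloisRep (5 ^ 1 : ℕ) :=
    hasSurjectiveModNGaloisRep_pow_5 1
  rw [pow_one] at hsur
  exact hSW _ not_hasCM (le_trans (by norm_num) three_le_rank) (by rw [conductorNorm_eq]; norm_num) 5
    (by norm_num) (by norm_num) goodOrdinary_5.1 goodOrdinary_5.2 hsur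

/-- **THE CRUX `KolyvaginDepthSupplyKN` AT THE RANK-THREE CURVE `5077a1`, MODULO ONE TWIST `5`-SELMER
BOUND.** Granted the two named print facts (Stein–Wuthrich 2013 Thm. 1.1; W. Zhang 2014 Lemma 8.4 (1) /
Thm. 9.1) and, for ONE imaginary quadratic `K` with `d_K = −7`, the bound `#Sel_5(E^{(d_K)}/ℚ) ≤ 5³` on the
Heegner twist, the CLAUSE of the crux holds at `W = 5077a1` VERBATIM: witnesses `p = 5` (good ordinary
`goodOrdinary_5`, `ρ_{E,5^∞}` onto `hasSurjectiveModNGaloisRep_pow_5`, Kodaira–Néron and ♠ from `Δ(E₀) = 5077`),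
that `K` (Heegner `heegner_neg7`; `5 ∤ 7`), W. Zhang's level-one class, first sign `ν + 1 ≤ rank`
(`5³ ≤ 5^rank` from `three_le_rank`). The twist `E^{(−7)}` has EVEN analytic rank (odd rank `3`, Heegner `K`);
Gross–Zagier's pair has `L(E^{(−7)}, 1) ≠ 0`, so the expected closing datum is `Sel_5(E^{(−7)}/ℚ) = 0` — a
RANK-ZERO datum (`cruxBody_of_twistSelmer_trivial_of_steinWuthrich`). CONDITIONAL on the two named facts and
the one twist datum; per curve (the open stub (S♭) is untouched); BSD is not proved by it.
[cite: SteinWuthrich2013, Thm. 1.1 (p. 1758)] [cite: WZhang2014, Lemma 8.4 (1) (p. 236), Thm. 9.1 (p. 240)]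
[cite: GrossZagier1986, §V.4] [cite: CremonaAlgorithms1997, Table 1 (5077a1)] -/
theorem cruxBody_of_twistSelmer
    (hSW : SteinWuthrich2013_sha_inf_torsionBy_eq_bot_of_two_le_rank)
    (h84 : Literature.NumberTheory.EllipticCurves.WZhang2014_lemma84_exists_minimal_kolyvaginClass_one_selmerCard)
    (K : Type) [Field K] [NumberField K] (hK : IsImaginaryQuadratic K)
    (hD : NumberField.discr K = -7)
    (hT : haveI := isElliptic_of_mem_atlasR3A00 mem_atlas;
      Nat.card (((c5077a1.e.baseChange ℚ).quadraticTwist (NumberField.discr K : ℚ)).selmerGroup (5 : ℕ)) ≤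
        5 ^ 3) :
    haveI := isElliptic_of_mem_atlasR3A00 mem_atlas;
    haveI := isGloballyMinimal_of_mem_atlasR3A00 mem_atlas;
    ∃ (p : ℕ) (hp : Fact p.Prime), 5 ≤ p ∧ (c5077a1.e.baseChange ℚ).HasGoodReductionAtPrime p ∧
      ¬ (p : ℤ) ∣ (c5077a1.e.baseChange ℚ).frobeniusTrace p ∧
      (∀ n : ℕ, (c5077a1.e.baseChange ℚ).HasSurjectiveModNGaloisRep (p ^ n : ℕ)) ∧
      (∀ v : HeightOneSpectrum (𝓞 ℚ), (c5077a1.e.baseChange ℚ).HasMultiplicativeReductionAt v →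
        ¬ p ∣ (c5077a1.e.baseChange ℚ).ordMinimalDiscriminant v) ∧
      ∃ (K : Type) (_ : Field K) (_ : NumberField K), IsImaginaryQuadratic K ∧
        NumberField.discr K ≠ -3 ∧ NumberField.discr K ≠ -4 ∧
        ∃ (_ : NeZero ((c5077a1.e.baseChange ℚ).conductorNorm ℤ)),
          SatisfiesHeegnerHypothesis ((c5077a1.e.baseChange ℚ).conductorNorm ℤ) K ∧
        ∃ (Dt : ModularParametrizationData (c5077a1.e.baseChange ℚ) ((c5077a1.e.baseChange ℚ).conductorNorm ℤ))
          (β : ℤ) (ι : K →+* ℂ) (n₁ : ℕ) (d : KolyvaginHeegnerData Dt β ι n₁), Squarefree n₁ ∧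
          (∀ q ∈ n₁.primeFactors,
            Zhang2014.IsKolyvaginPrime ((c5077a1.e.baseChange ℚ).conductorNorm ℤ) (c5077a1.e.baseChange ℚ) K p q) ∧
          d.kolyvaginClass hp.out 1 ≠ 0 ∧
          (n₁.primeFactors.card + 1 ≤ (c5077a1.e.baseChange ℚ).mordellWeilRank ∨
            (n₁.primeFactors.card ≤ (c5077a1.e.baseChange ℚ).mordellWeilRank ∧
              n₁.primeFactors.card + 1 ≤
                ((c5077a1.e.baseChange ℚ).quadraticTwist (NumberField.discr K : ℚ)).mordellWeilRank)) := by
  haveI := isElliptic_of_mem_atlasR3A00 mem_atlas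
  haveI := isGloballyMinimal_of_mem_atlasR3A00 mem_atlas
  haveI iNZ : NeZero ((c5077a1.e.baseChange ℚ).conductorNorm ℤ) := neZero_conductorNorm_of_isElliptic _
  haveI i5 := Fact.mk (by norm_num : Nat.Prime 5)
  have hsp := spade_5
  have hKN : ∀ v : HeightOneSpectrum (𝓞 ℚ), (c5077a1.e.baseChange ℚ).HasMultiplicativeReductionAt v →
      ¬ 5 ∣ (c5077a1.e.baseChange ℚ).ordMinimalDiscriminant v :=
    not_dvd_ordMinimalDiscriminant_of_intModel_table intModel (p := 5) (Δ₀ := 5077) (by decide +kernel)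
      (B := 8) (by decide +kernel) (by decide +kernel)
  have hS2 : ¬ Squarefree ((c5077a1.e.baseChange ℚ).conductorNorm ℤ) →
      (∃ (ℓ : ℕ) (_ : Fact ℓ.Prime), (c5077a1.e.baseChange ℚ).HasMultiplicativeReductionAtPrime ℓ ∧
          ¬ 5 ∣ padicValInt ℓ (c5077a1.e.baseChange ℚ).minimalDiscriminantInt) ∧
        ∃ (ℓ₁ ℓ₂ : ℕ) (_ : Fact ℓ₁.Prime) (_ : Fact ℓ₂.Prime), ℓ₁ ≠ ℓ₂ ∧
          (c5077a1.e.baseChange ℚ).HasMultiplicativeReductionAtPrime ℓ₁ ∧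
            (c5077a1.e.baseChange ℚ).HasMultiplicativeReductionAtPrime ℓ₂ :=
    fun hns ↦ absurd ((c5077a1.e.baseChange ℚ).isSemistable_iff_squarefree_conductorNorm.mp hsp.2) hns
  have hH := satisfiesHeegnerHypothesis_conductorNorm_of_intModel intModel K hK.1 hD heegner_neg7
  have hD3 : NumberField.discr K ≠ -3 := by rw [hD]; norm_num
  have hD4 : NumberField.discr K ≠ -4 := by rw [hD]; norm_num
  have hpD : ¬ (((5 : ℕ) : ℤ) ∣ NumberField.discr K) := by rw [hD]; norm_num
  have hr3 : 3 ≤ (c5077a1.e.baseChange ℚ).mordellWeilRank := three_le_rank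
  have hT' : Nat.card (((c5077a1.e.baseChange ℚ).quadraticTwist (NumberField.discr K : ℚ)).selmerGroup (5 : ℕ)) ≤
      5 ^ (c5077a1.e.baseChange ℚ).mordellWeilRank :=
    le_trans hT (Nat.pow_le_pow_right (by norm_num) hr3)
  exact cruxBody_of_twistSelmer_of_steinWuthrich hSW h84 _ not_hasCM (le_trans (by norm_num) hr3)
    (by rw [conductorNorm_eq]; norm_num) 5 (by norm_num) (by norm_num) goodOrdinary_5.1 goodOrdinary_5.2
    hasSurjectiveModNGaloisRep_pow_5 hKN hsp.1 hS2 K hK hD3 hD4 hpD hH hT'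

end C5077a1

end Summit.BirchSwinnertonDyer.BirchSwinnertonDyer.Theorems.KolyvaginDepthDoor

end
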